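import Literature.NumberTheory.EllipticCurves.BigGaloisRepSelmer
import Literature.NumberTheory.EllipticCurves.CharIdealDualLocalizationStepProofs
import HarnessLib

/-!
# The ONE-SIDED `Σ`-change for the big anticyclotomic Selmer dual:
# `Ch(X^{Σ₁}) · ∏_{w ∈ Σ₂∖Σ₁} (P_w) ⊆ Ch(X^{Σ₂})` and `X^{Σ₂}` torsion, from local data at the extra places

THEOREMS ONLY (no definition, no named fact, no `sorry`). For the tree's `Sel^Σ_𝔮(K, M)`,
`M = T ⊗_𝒪 Λ_𝒪^*(Ψ⁻¹)` (`BigGaloisRep.selmerBigDecomp κ ρ 𝔮 Σ`, Castella 2018 Def. 2.2: trivial classes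
in `H¹(K_w, M)` at `𝔮` and at every finite `w ∉ Σ`, `w ∤ p`) and its Pontryagin dual `X^Σ = XBigDecomp`:
enlarging `Σ` by one place `w ∉ Σ`, `w ∤ p`, gives `Sel^Σ ↪ Sel^{Σ ∪ {w}} → H¹(K_w, M)` EXACT (the class of
`Sel^{Σ∪{w}}` lies in `Sel^Σ` iff it dies in `H¹(K_w, M)`; NO surjectivity is claimed), so the generic
step `Module.isTorsion_and_charIdeal_mul_span_le_of_exact_dual` yields: if `X^Σ` is torsion, `X^{Σ∪{w}}`
finitely generated, and `H¹(K_w, M)^∨` finitely generated torsion with `P_w ∈ Ch(H¹(K_w, M)^∨)`, then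
`X^{Σ∪{w}}` is torsion and `Ch(X^Σ)·(P_w) ⊆ Ch(X^{Σ∪{w}})`; induction on a finite set of extra places gives
the displayed inclusion. This is the containment "`Ch^{Σ₂}_L(f) ⊇ Ch^{Σ₁}_L(f) · ∏_{ℓ∈Σ₂∖Σ₁} (P_ℓ(Ψ⁻¹ε⁻¹(frob_ℓ)))`"
of [Skinner2016PacificMC] §2.3 (p. 180) ∕ the display of the proof of [JetchevSkinnerWan2017] Thm. 6.1.6
WITHOUT its equality half (which needs the surjectivity of localisation, JSW Prop. 3.3.2 ∕ Poitou–Tate),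
over any coefficient ring `𝒪` with `Λ_𝒪 = 𝒪⟦T⟧` a Noetherian domain, any `κ`, `ρ`, `𝔮`.

* `BigGaloisRep.selmerBigDecomp_mono` — `Sel^{Σ₁} ≤ Sel^{Σ₂}` for `Σ₁ ⊆ Σ₂`;
* `BigGaloisRep.mem_selmerBigDecomp_of_mem_insert_iff`, `BigGaloisRep.exact_inclusion_resH1_selmerBigDecomp_insert`
  — exactness at the extra place;
* **`BigGaloisRep.XBigDecomp.isTorsion_and_charIdeal_mul_span_le_insert`** — one place;
* **`BigGaloisRep.XBigDecomp.isTorsion_and_charIdeal_mul_span_prod_le`** — finitely many places.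

Cell `bsd-stepL` (K2 support 20338 ∕ 20427), seat `bsd-stepL-imc-p1` (prover g12, 2026-08-27).
References: [Skinner2016PacificMC] §2.3 (p. 180); [JetchevSkinnerWan2017] §3.3, proof of Thm. 6.1.6
(arXiv:1512.06894 tex p0026 L82–96); [Castella2018] Def. 2.2 (p. 4); [GreenbergVatsal2000] §2.
-/

noncomputable section

open Field IsDedekindDomain NumberField
open Literature.NumberTheory.GaloisRepresentations

universe u

namespace Literature.NumberTheory.EllipticCurves.BigGaloisRep

variable {K : Type u} [Field K] [NumberField K] {p : ℕ} [Fact p.Prime]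
variable {𝒪 : Type*} [CommRing 𝒪] [TopologicalSpace 𝒪]
variable {A : Type u} [AddCommGroup A] [Module 𝒪 A] [TopologicalSpace A] [DiscreteTopology A]
variable [TopologicalSpace (PowerSeries 𝒪)] [ContinuousSMul (PowerSeries 𝒪) (BigRepModule 𝒪 p A)]
variable (κ : ZpExtension K p) (ρ : ContinuousRep (absoluteGaloisGroup K) 𝒪 A)
  (𝔮 : HeightOneSpectrum (𝓞 K))

/-- `Sel^{Σ}_𝔮(K, M)` (Def. 2.2 strict set) grows with `Σ`. [cite: Castella2018, Def. 2.2 (p. 4, "`Σ`-imprimitive")] -/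
theorem selmerBigDecomp_mono {S₁ S₂ : Set (HeightOneSpectrum (𝓞 K))} (h : S₁ ⊆ S₂) :
    selmerBigDecomp κ ρ 𝔮 S₁ ≤ selmerBigDecomp κ ρ 𝔮 S₂ :=
  selmer_anti (localMap K) _ (strictSetDecomp_anti p 𝔮 h)

/-- **The extra local condition.** For `w ∉ Σ` with `w ∤ p`, a class of `Sel^{Σ ∪ {w}}_𝔮(K, M)` lies
in `Sel^Σ_𝔮(K, M)` iff its restriction to `H¹(K_w, M)` vanishes (Def. 2.2: `Sel^Σ` is cut out of
`Sel^{Σ∪{w}}` by the single extra condition at `w`; stated with the restriction as the linear map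
`(resH1 …).hom.toLinearMap`, the form in which `BigGaloisRep.selmer` is defined).
[cite: Castella2018, Def. 2.2 (p. 4, "dropping the summands `H¹(K_w, 𝒜)` for the places `w ∈ Σ`")] -/
theorem mem_selmerBigDecomp_of_mem_insert_iff {S : Set (HeightOneSpectrum (𝓞 K))}
    {w : HeightOneSpectrum (𝓞 K)} (hw : w ∉ S) (hwp : ((p : ℕ) : 𝓞 K) ∉ w.asIdeal)
    {x : continuousCohomology 1 (AnticyclotomicBigGaloisRep κ ρ).toTopRep}
    (hx : x ∈ selmerBigDecomp κ ρ 𝔮 (insert w S)) :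
    x ∈ selmerBigDecomp κ ρ 𝔮 S ↔
      (resH1 (AnticyclotomicBigGaloisRep κ ρ) (localMap K (Sum.inl w))).hom.toLinearMap x = 0 := by
  simp only [selmerBigDecomp, selmer, Submodule.mem_iInf, LinearMap.mem_ker] at hx ⊢
  constructor
  · intro h
    exact h _ ((inl_mem_strictSetDecomp_iff p 𝔮 w S).2 (Or.inr ⟨hw, hwp⟩))
  · rintro h (v | v) hv
    · rcases (inl_mem_strictSetDecomp_iff p 𝔮 v S).1 hv with rfl | ⟨hvS, hvp⟩
      · exact hx _ ((inl_mem_strictSetDecomp_iff p v v (insert w S)).2 (Or.inl rfl))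
      · by_cases hvw : v = w
        · subst hvw
          exact h
        · exact hx _ ((inl_mem_strictSetDecomp_iff p 𝔮 v (insert w S)).2
            (Or.inr ⟨fun h' => h'.elim hvw hvS, hvp⟩))
    · exact (inr_not_mem_strictSetDecomp p 𝔮 v S hv).elim

/-- **Exactness at one extra place**: for `w ∉ Σ`, `w ∤ p`, the pair
`Sel^Σ_𝔮(K, M) ↪ Sel^{Σ∪{w}}_𝔮(K, M) → H¹(K_w, M)` (inclusion, restriction) is exact — NO surjectivity
of the restriction is claimed. [cite: Castella2018, Def. 2.2 (p. 4)]
[cite: JetchevSkinnerWan2017, §3.3 (restrict-eq1) and proof of Thm. 6.1.6 (the local term at `w ∈ Σ₂ ∖ Σ₁`)] -/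
theorem exact_inclusion_resH1_selmerBigDecomp_insert {S : Set (HeightOneSpectrum (𝓞 K))}
    {w : HeightOneSpectrum (𝓞 K)} (hw : w ∉ S) (hwp : ((p : ℕ) : 𝓞 K) ∉ w.asIdeal) :
    Function.Exact
      (Submodule.inclusion (selmerBigDecomp_mono κ ρ 𝔮 (Set.subset_insert w S)))
      ((resH1 (AnticyclotomicBigGaloisRep κ ρ) (localMap K (Sum.inl w))).hom.toLinearMap.comp
        (selmerBigDecomp κ ρ 𝔮 (insert w S)).subtype) := by
  rw [LinearMap.exact_iff, Submodule.range_inclusion]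
  ext y
  rw [LinearMap.mem_ker, LinearMap.comp_apply, Submodule.subtype_apply, Submodule.mem_comap,
    Submodule.subtype_apply]
  exact (mem_selmerBigDecomp_of_mem_insert_iff κ ρ 𝔮 hw hwp y.2).symm

variable [IsNoetherianRing (PowerSeries 𝒪)] [IsDomain (PowerSeries 𝒪)]

/-- **One place.** `w ∉ Σ`, `w ∤ p`; if `X^Σ` is torsion, `X^{Σ∪{w}}` is finitely generated, and the
Pontryagin dual of `H¹(K_w, M)` is finitely generated torsion over `Λ_𝒪` with `P ∈ Ch(H¹(K_w, M)^∨)`,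
then `X^{Σ∪{w}}` is torsion and `Ch(X^Σ) · (P) ⊆ Ch(X^{Σ∪{w}})`.
[cite: Skinner2016PacificMC, §2.3 (p. 180, "`Ch^{Σ₂}_L(f) ⊇ Ch^{Σ₁}_L(f) · ∏_{ℓ∈Σ₂∖Σ₁} (P_ℓ(Ψ⁻¹ε⁻¹(frob_ℓ)))`")]
[cite: JetchevSkinnerWan2017, proof of Thm. 6.1.6 (arXiv:1512.06894 tex p0026 L82–96)] -/
theorem XBigDecomp.isTorsion_and_charIdeal_mul_span_le_insert {S : Set (HeightOneSpectrum (𝓞 K))}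
    {w : HeightOneSpectrum (𝓞 K)} (hw : w ∉ S) (hwp : ((p : ℕ) : 𝓞 K) ∉ w.asIdeal)
    [Module.Finite (PowerSeries 𝒪) (XBigDecomp κ ρ 𝔮 (insert w S))]
    (hS : Module.IsTorsion (PowerSeries 𝒪) (XBigDecomp κ ρ 𝔮 S))
    [Module.Finite (PowerSeries 𝒪) (CharacterModule
      (continuousCohomology 1
        ((AnticyclotomicBigGaloisRep κ ρ).restrict (localMap K (Sum.inl w))).toTopRep))]
    (hL : Module.IsTorsion (PowerSeries 𝒪) (CharacterModule
      (continuousCohomology 1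
        ((AnticyclotomicBigGaloisRep κ ρ).restrict (localMap K (Sum.inl w))).toTopRep)))
    {P : PowerSeries 𝒪}
    (hP : P ∈ Module.charIdeal (PowerSeries 𝒪) (CharacterModule
      (continuousCohomology 1
        ((AnticyclotomicBigGaloisRep κ ρ).restrict (localMap K (Sum.inl w))).toTopRep))) :
    Module.IsTorsion (PowerSeries 𝒪) (XBigDecomp κ ρ 𝔮 (insert w S)) ∧
      Module.charIdeal (PowerSeries 𝒪) (XBigDecomp κ ρ 𝔮 S) * Ideal.span {P} ≤
        Module.charIdeal (PowerSeries 𝒪) (XBigDecomp κ ρ 𝔮 (insert w S)) :=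
  Module.isTorsion_and_charIdeal_mul_span_le_of_exact_dual _
    (Submodule.inclusion_injective (selmerBigDecomp_mono κ ρ 𝔮 (Set.subset_insert w S))) _
    (exact_inclusion_resH1_selmerBigDecomp_insert κ ρ 𝔮 hw hwp) hS hL hP

/-- **Finitely many places** (induction on the one-place step): for a finite set `F` of places
`w ∉ Σ`, `w ∤ p`, with `X^{Σ ∪ F'}` finitely generated for every `F' ⊆ F`, `X^Σ` torsion, and at each
`w ∈ F` the dual of `H¹(K_w, M)` finitely generated torsion with `P_w ∈ Ch(H¹(K_w, M)^∨)`: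
`X^{Σ ∪ F}` is torsion and **`Ch(X^Σ) · (∏_{w∈F} P_w) ⊆ Ch(X^{Σ ∪ F})`** — the one-sided `Σ`-change.
[cite: Skinner2016PacificMC, §2.3 (p. 180, "`Ch^{Σ₂}_L(f) ⊇ Ch^{Σ₁}_L(f) · ∏_{ℓ∈Σ₂∖Σ₁} (P_ℓ(Ψ⁻¹ε⁻¹(frob_ℓ)))`")]
[cite: JetchevSkinnerWan2017, proof of Thm. 6.1.6 (arXiv:1512.06894 tex p0026 L82–96)] -/
theorem XBigDecomp.isTorsion_and_charIdeal_mul_span_prod_le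
    {S : Set (HeightOneSpectrum (𝓞 K))} (F : Finset (HeightOneSpectrum (𝓞 K)))
    (hF : ∀ w ∈ F, w ∉ S ∧ ((p : ℕ) : 𝓞 K) ∉ w.asIdeal)
    (hfin : ∀ F' : Finset (HeightOneSpectrum (𝓞 K)), F' ⊆ F →
      Module.Finite (PowerSeries 𝒪) (XBigDecomp κ ρ 𝔮 (S ∪ ↑F')))
    (hS : Module.IsTorsion (PowerSeries 𝒪) (XBigDecomp κ ρ 𝔮 S))
    (P : HeightOneSpectrum (𝓞 K) → PowerSeries 𝒪)
    (hloc : ∀ w ∈ F,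
      Module.Finite (PowerSeries 𝒪) (CharacterModule (continuousCohomology 1
        ((AnticyclotomicBigGaloisRep κ ρ).restrict (localMap K (Sum.inl w))).toTopRep)) ∧
      Module.IsTorsion (PowerSeries 𝒪) (CharacterModule (continuousCohomology 1
        ((AnticyclotomicBigGaloisRep κ ρ).restrict (localMap K (Sum.inl w))).toTopRep)) ∧
      P w ∈ Module.charIdeal (PowerSeries 𝒪) (CharacterModule (continuousCohomology 1
        ((AnticyclotomicBigGaloisRep κ ρ).restrict (localMap K (Sum.inl w))).toTopRep)))
    {S₂ : Set (HeightOneSpectrum (𝓞 K))} (hS₂ : S₂ = S ∪ ↑F) :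
    Module.IsTorsion (PowerSeries 𝒪) (XBigDecomp κ ρ 𝔮 S₂) ∧
      Module.charIdeal (PowerSeries 𝒪) (XBigDecomp κ ρ 𝔮 S) * Ideal.span {∏ w ∈ F, P w} ≤
        Module.charIdeal (PowerSeries 𝒪) (XBigDecomp κ ρ 𝔮 S₂) := by
  classical
  induction F using Finset.induction_on generalizing S₂ with
  | empty =>
    rw [Finset.coe_empty, Set.union_empty] at hS₂
    subst hS₂
    rw [Finset.prod_empty, Ideal.span_singleton_one, Ideal.mul_top]
    exact ⟨hS, le_rfl⟩
  | @insert w F hwF ih =>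
    have hF' : ∀ v ∈ F, v ∉ S ∧ ((p : ℕ) : 𝓞 K) ∉ v.asIdeal :=
      fun v hv => hF v (Finset.mem_insert_of_mem hv)
    have hfin' : ∀ F' : Finset (HeightOneSpectrum (𝓞 K)), F' ⊆ F →
        Module.Finite (PowerSeries 𝒪) (XBigDecomp κ ρ 𝔮 (S ∪ ↑F')) :=
      fun F' hF'F => hfin F' (hF'F.trans (Finset.subset_insert w F))
    have hloc' := fun v hv => hloc v (Finset.mem_insert_of_mem hv)
    obtain ⟨hT, hCh⟩ := ih hF' hfin' hloc' rfl
    obtain ⟨hwS, hwp⟩ := hF w (Finset.mem_insert_self w F)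
    obtain ⟨hfinw, hLw, hPw⟩ := hloc w (Finset.mem_insert_self w F)
    have hw' : w ∉ S ∪ (↑F : Set (HeightOneSpectrum (𝓞 K))) := by
      rintro (h | h)
      · exact hwS h
      · exact hwF (Finset.mem_coe.mp h)
    have hfin₂ := hfin (insert w F) (Finset.Subset.refl _)
    rw [Finset.coe_insert, Set.union_insert] at hfin₂ hS₂
    subst hS₂
    haveI := hfin₂
    haveI := hfinw
    obtain ⟨hT₂, hCh₂⟩ :=
      XBigDecomp.isTorsion_and_charIdeal_mul_span_le_insert κ ρ 𝔮 hw' hwp hT hLw hPw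
    refine ⟨hT₂, ?_⟩
    rw [Finset.prod_insert hwF]
    calc Module.charIdeal (PowerSeries 𝒪) (XBigDecomp κ ρ 𝔮 S) * Ideal.span {P w * ∏ v ∈ F, P v}
        = (Module.charIdeal (PowerSeries 𝒪) (XBigDecomp κ ρ 𝔮 S) * Ideal.span {∏ v ∈ F, P v}) *
            Ideal.span {P w} := by
          rw [mul_comm (P w), ← Ideal.span_singleton_mul_span_singleton, mul_assoc]
      _ ≤ Module.charIdeal (PowerSeries 𝒪) (XBigDecomp κ ρ 𝔮 (S ∪ ↑F)) * Ideal.span {P w} :=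
          Ideal.mul_mono_left hCh
      _ ≤ Module.charIdeal (PowerSeries 𝒪) (XBigDecomp κ ρ 𝔮 (insert w (S ∪ ↑F))) := hCh₂

end Literature.NumberTheory.EllipticCurves.BigGaloisRep

end
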